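import Mathlib.Data.Real.Basic
import Mathlib.Tactic.Linarith
import Mathlib.Tactic.Ring
import HarnessLib

/-!
# `NoHeavyLowerTail` (stmt-CriticalPhenomena-4575) — THEOREM C (borrowing certificate): the real arithmetic

Support file (`--supports stmt-CriticalPhenomena-4575`, hull-port prover `prim-hp-2`, gen 25).  No definitions, no named facts,
no sorries; standard axioms.  The division-free assembly of the ten pocket-augmented BHK rows, pocket superadditivity, the two
slack inclusions and the borrowing hypotheses into Kozma–Nitzan's `I + II + III ≥ 0` (prim-hp-2 MEMO-gen25 §1), isolated as a
statement about real numbers so that the measure-theoretic file `…KNGoodThreeRelaysBorrow.lean` stays short.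
[cite: KozmaNitzan2024, Thm. 2 (p. 8–9)]
-/

namespace Summit.CriticalPhenomena.PercolationContinuityZ3.Theorems

namespace KNGoodThreeKN

set_option maxHeartbeats 1600000 in
/-- **The borrowing arithmetic.**  Cells: hub (`dK = Q(D_K)`, `fK = μ(F;D_K)`, `u5, u35, u45` up-cells, `d67` down-cell,
`q5, q67, Q3, Q4` world masses), camp `a` (`da, fa, rA, qRa, d9, q9, x49, q49, Q14`), camp `t` (`dt, ft, rT, qRt, d8, q8, x38,
q38, Q12`); rows `b1 … b10`, superadditivity `psa`, slack inclusions `S1, S2`, borrowing hypotheses `hβ', hγ', hs0`; the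
degenerate alternatives `hdeg` come from Harris' inequality.  Conclusion: `d67 + d9 + d8 ≤ u5 + rA + rT`.
[cite: KozmaNitzan2024, Thm. 2 (p. 9)] -/
theorem borrow_arith (β γ dK fK u5 q5 d67 q67 u35 q35 u45 q45 Q3 Q4 da fa rA qRa d9 q9 x49 q49 Q14 dt ft rT qRt d8 q8 x38 q38
      Q12 : ℝ)
    (hβ0 : 0 ≤ β) (hγ0 : 0 ≤ γ) (hβγ : β + γ ≤ 1)
    (h0dK : 0 ≤ dK) (h0da : 0 ≤ da) (h0dt : 0 ≤ dt) (h0fK : 0 ≤ fK) (h0fa : 0 ≤ fa) (h0ft : 0 ≤ ft)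
    (h0rA : 0 ≤ rA) (h0rT : 0 ≤ rT) (h0u5 : 0 ≤ u5) (h0u35 : 0 ≤ u35) (h0u45 : 0 ≤ u45) (h0x49 : 0 ≤ x49) (h0x38 : 0 ≤ x38)
    (h0Q3 : 0 ≤ Q3) (h0Q4 : 0 ≤ Q4) (h0d67 : 0 ≤ d67) (h0d9 : 0 ≤ d9) (h0d8 : 0 ≤ d8) (h0q5 : 0 ≤ q5) (h0q67 : 0 ≤ q67)
    (hu5 : u5 ≤ dK) (hd67 : d67 ≤ dK) (hu35 : u35 ≤ dK) (hu45 : u45 ≤ dK) (hq5 : q5 ≤ dK) (hq67 : q67 ≤ dK)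
    (hQ3 : Q3 ≤ dK) (hQ4 : Q4 ≤ dK) (hrA : rA ≤ da) (hd9 : d9 ≤ da) (hx49 : x49 ≤ da) (hrT : rT ≤ dt) (hd8 : d8 ≤ dt)
    (hx38 : x38 ≤ dt)
    (b1 : q5 * fK ≤ dK * u5) (b2 : dK * d67 ≤ q67 * fK) (b7 : q35 * fK ≤ dK * u35) (b8 : q45 * fK ≤ dK * u45)
    (b3 : qRa * fa ≤ da * rA) (b4 : da * d9 ≤ q9 * fa) (b9 : da * x49 ≤ q49 * fa)
    (b5 : qRt * ft ≤ dt * rT) (b6 : dt * d8 ≤ q8 * ft) (b10 : dt * x38 ≤ q38 * ft)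
    (psa : fa * dt * dK + ft * da * dK ≤ fK * da * dt)
    (e35 : q35 = Q3 + q5) (e45 : q45 = Q4 + q5) (eRa : qRa = Q3 + Q14) (eRt : qRt = Q4 + Q12) (e49 : q49 = Q4 + q9)
    (e38 : q38 = Q3 + q8)
    (hβ' : β * Q14 ≤ q5 + qRa - q67 - q9) (hγ' : γ * Q12 ≤ q5 + qRt - q67 - q8) (hs0 : 0 ≤ β * Q3 + γ * Q4 - (q67 - q5))
    (S1 : u35 + d8 ≤ u5 + rA + x38) (S2 : u45 + d9 ≤ u5 + rT + x49)
    (hdeg : dK = 0 ∨ (0 < dK ∧ 0 < da ∧ 0 < dt) ∨ (0 < dK ∧ da = 0 ∧ dt = 0)) :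
    d67 + d9 + d8 ≤ u5 + rA + rT := by
  have hα0 : 0 ≤ 1 - β - γ := by linarith
  have hβ1 : 0 ≤ 1 - β := by linarith
  have hγ1 : 0 ≤ 1 - γ := by linarith
  set s := β * Q3 + γ * Q4 - (q67 - q5) with hs
  -- the three chain bounds (no division)
  have A1 : fK * s ≤ dK * ((1 - β - γ) * u5 + β * u35 + γ * u45 - d67) := by
    have t1 := mul_le_mul_of_nonneg_left b1 hα0
    have t7 := mul_le_mul_of_nonneg_left b7 hβ0
    have t8 := mul_le_mul_of_nonneg_left b8 hγ0
    have key : fK * s = (1 - β - γ) * (q5 * fK) + β * (q35 * fK) + γ * (q45 * fK) - q67 * fK := by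
      rw [hs, e35, e45]; ring
    rw [key]; linarith [t1, t7, t8, b2]
  have A2 : fa * ((q5 + qRa - q67 - q9) - β * Q14 - s) ≤ da * ((1 - β) * rA - (1 - γ) * d9 - γ * x49) := by
    have t3 := mul_le_mul_of_nonneg_left b3 hβ1
    have t4 := mul_le_mul_of_nonneg_left b4 hγ1
    have t9 := mul_le_mul_of_nonneg_left b9 hγ0
    have key : fa * ((q5 + qRa - q67 - q9) - β * Q14 - s) =
        (1 - β) * (qRa * fa) - (1 - γ) * (q9 * fa) - γ * (q49 * fa) := by
      rw [hs, eRa, e49]; ring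
    rw [key]; linarith [t3, t4, t9]
  have A3 : ft * ((q5 + qRt - q67 - q8) - γ * Q12 - s) ≤ dt * ((1 - γ) * rT - (1 - β) * d8 - β * x38) := by
    have t5 := mul_le_mul_of_nonneg_left b5 hγ1
    have t6 := mul_le_mul_of_nonneg_left b6 hβ1
    have t10 := mul_le_mul_of_nonneg_left b10 hβ0
    have key : ft * ((q5 + qRt - q67 - q8) - γ * Q12 - s) =
        (1 - γ) * (qRt * ft) - (1 - β) * (q8 * ft) - β * (q38 * ft) := by
      rw [hs, eRt, e38]; ring
    rw [key]; linarith [t5, t6, t10]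
  -- the target dominates I'' + II'' + III''
  have dom : (1 - β - γ) * u5 + β * u35 + γ * u45 - d67 + ((1 - β) * rA - (1 - γ) * d9 - γ * x49) +
      ((1 - γ) * rT - (1 - β) * d8 - β * x38) ≤ (u5 + rA + rT) - (d67 + d9 + d8) := by
    have s1 := mul_le_mul_of_nonneg_left S1 hβ0
    have s2 := mul_le_mul_of_nonneg_left S2 hγ0
    linarith [s1, s2]
  rcases hdeg with hK0 | ⟨hKpos, hapos, htpos⟩ | ⟨hKpos, ha0, ht0⟩
  · -- all hub cells vanish, hence s = 0
    have hu50 : u5 = 0 := le_antisymm (hK0 ▸ hu5) h0u5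
    have hd670 : d67 = 0 := le_antisymm (hK0 ▸ hd67) h0d67
    have hu350 : u35 = 0 := le_antisymm (hK0 ▸ hu35) h0u35
    have hu450 : u45 = 0 := le_antisymm (hK0 ▸ hu45) h0u45
    have hq50 : q5 = 0 := le_antisymm (hK0 ▸ hq5) h0q5
    have hq670 : q67 = 0 := le_antisymm (hK0 ▸ hq67) h0q67
    have hQ30 : Q3 = 0 := le_antisymm (hK0 ▸ hQ3) h0Q3
    have hQ40 : Q4 = 0 := le_antisymm (hK0 ▸ hQ4) h0Q4
    have hs00 : s = 0 := by rw [hs, hQ30, hQ40, hq50, hq670]; ring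
    have Ea' : 0 ≤ (1 - β) * rA - (1 - γ) * d9 - γ * x49 := by
      by_cases ha0 : da = 0
      · have hrA0 : rA = 0 := le_antisymm (ha0 ▸ hrA) h0rA
        have hd90 : d9 = 0 := le_antisymm (ha0 ▸ hd9) h0d9
        have hx490 : x49 = 0 := le_antisymm (ha0 ▸ hx49) h0x49
        rw [hrA0, hd90, hx490]; linarith
      · have hpos : 0 < da := lt_of_le_of_ne h0da (Ne.symm ha0)
        have h2 : 0 ≤ fa * ((q5 + qRa - q67 - q9) - β * Q14 - s) :=
          mul_nonneg h0fa (by rw [hs00]; linarith [hβ'])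
        exact (mul_nonneg_iff_of_pos_left hpos).1 (le_trans h2 A2)
    have Et' : 0 ≤ (1 - γ) * rT - (1 - β) * d8 - β * x38 := by
      by_cases ht0 : dt = 0
      · have hrT0 : rT = 0 := le_antisymm (ht0 ▸ hrT) h0rT
        have hd80 : d8 = 0 := le_antisymm (ht0 ▸ hd8) h0d8
        have hx380 : x38 = 0 := le_antisymm (ht0 ▸ hx38) h0x38
        rw [hrT0, hd80, hx380]; linarith
      · have hpos : 0 < dt := lt_of_le_of_ne h0dt (Ne.symm ht0)
        have h2 : 0 ≤ ft * ((q5 + qRt - q67 - q8) - γ * Q12 - s) :=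
          mul_nonneg h0ft (by rw [hs00]; linarith [hγ'])
        exact (mul_nonneg_iff_of_pos_left hpos).1 (le_trans h2 A3)
    rw [hu50, hd670, hu350, hu450] at dom
    rw [hu50, hd670]
    linarith [dom, Ea', Et']
  · generalize hIK : (1 - β - γ) * u5 + β * u35 + γ * u45 - d67 = IK at A1 dom
    generalize hIA : (1 - β) * rA - (1 - γ) * d9 - γ * x49 = IA at A2 dom
    generalize hIT : (1 - γ) * rT - (1 - β) * d8 - β * x38 = IT at A3 dom
    generalize hVA : q5 + qRa - q67 - q9 - β * Q14 - s = VA at A2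
    generalize hVT : q5 + qRt - q67 - q8 - γ * Q12 - s = VT at A3
    have hVA0 : 0 ≤ VA + s := by rw [← hVA]; linarith only [hβ']
    have hVT0 : 0 ≤ VT + s := by rw [← hVT]; linarith only [hγ']
    have hdadt : 0 ≤ da * dt := mul_nonneg h0da h0dt
    have hdKdt : 0 ≤ dK * dt := mul_nonneg h0dK h0dt
    have hdKda : 0 ≤ dK * da := mul_nonneg h0dK h0da
    have T1 : da * dt * (fK * s) ≤ da * dt * (dK * IK) := mul_le_mul_of_nonneg_left A1 hdadt
    have T2 : s * (fa * dt * dK + ft * da * dK) ≤ s * (fK * da * dt) := mul_le_mul_of_nonneg_left psa hs0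
    have T3 : dK * dt * (fa * VA) ≤ dK * dt * (da * IA) := mul_le_mul_of_nonneg_left A2 hdKdt
    have T4 : dK * da * (ft * VT) ≤ dK * da * (dt * IT) := mul_le_mul_of_nonneg_left A3 hdKda
    have P1 : 0 ≤ dK * dt * fa * (VA + s) := mul_nonneg (mul_nonneg hdKdt h0fa) hVA0
    have P2 : 0 ≤ dK * da * ft * (VT + s) := mul_nonneg (mul_nonneg hdKda h0ft) hVT0
    have e1 : da * dt * (fK * s) = s * (fK * da * dt) := by ring
    have e2 : s * (fa * dt * dK + ft * da * dK) + dK * dt * (fa * VA) + dK * da * (ft * VT) =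
        dK * dt * fa * (VA + s) + dK * da * ft * (VT + s) := by ring
    have e3 : da * dt * (dK * IK) + dK * dt * (da * IA) + dK * da * (dt * IT) = dK * da * dt * (IK + IA + IT) := by ring
    have tot : 0 ≤ dK * da * dt * (IK + IA + IT) := by
      linarith only [T1, T2, T3, T4, P1, P2, e1, e2, e3]
    have hP : 0 < dK * da * dt := mul_pos (mul_pos hKpos hapos) htpos
    have hsum : 0 ≤ IK + IA + IT := (mul_nonneg_iff_of_pos_left hP).1 tot
    linarith only [hsum, dom]
  · have hrA0 : rA = 0 := le_antisymm (ha0 ▸ hrA) h0rA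
    have hd90 : d9 = 0 := le_antisymm (ha0 ▸ hd9) h0d9
    have hx490 : x49 = 0 := le_antisymm (ha0 ▸ hx49) h0x49
    have hrT0 : rT = 0 := le_antisymm (ht0 ▸ hrT) h0rT
    have hd80 : d8 = 0 := le_antisymm (ht0 ▸ hd8) h0d8
    have hx380 : x38 = 0 := le_antisymm (ht0 ▸ hx38) h0x38
    rw [hrA0, hd90, hx490, hrT0, hd80, hx380] at dom
    rw [hrA0, hd90, hrT0, hd80]
    have h1 : 0 ≤ fK * s := mul_nonneg h0fK hs0
    have h2 : 0 ≤ dK * ((1 - β - γ) * u5 + β * u35 + γ * u45 - d67) := le_trans h1 A1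
    have h3 := (mul_nonneg_iff_of_pos_left hKpos).1 h2
    linarith only [dom, h3, h0u5, h0u35, h0u45, h0d67, hβ0, hγ0, hα0]

end KNGoodThreeKN

end Summit.CriticalPhenomena.PercolationContinuityZ3.Theorems
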